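import Summits.NavierStokesRegularity.NavierStokesRegularity.Theses.TypeICertificateLadder
import Literature.Dynamics.Ergodic.ErgodicOptimizationProofs

/-!
# Route TypeICertificateLadder — ErgodicOptimisationDuality (item stmt-NavierStokesRegularity-2885)

The abstract "completeness core" of route `TypeICertificateLadder` for `NavierStokesRegularity`:
for a continuous self-map `Φ` of a compact metric space `K` (Borel σ-algebra) and a continuous
`F : K → ℝ`, if every `Φ`-invariant Borel probability measure `μ` has `∫ F dμ < β`, then some
CONTINUOUS `g : K → ℝ` satisfies `F x + g (Φ x) - g x < β` for every `x` — the non-trivial half of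
the ergodic-optimisation duality `sup_μ ∫ F dμ = inf_{g ∈ C(K)} sup_x (F + g ∘ Φ − g)`
(O. Jenkinson, *Ergodic optimization in dynamical systems*, Ergodic Theory Dynam. Systems 39 (2019),
§2, Prop. 2.2; flow version: Tobasco–Goluskin–Doering 2018).

Proof (Jenkinson's device + Krylov–Bogolyubov, the latter already in the tree as
`Literature.Dynamics.Ergodic.exists_invariantMeasure_tendsto_timeAverage`). Write
`Sₙ = birkhoffSum Φ F n`. Either some `n ≥ 1` has `Sₙ(x)/n < β` for all `x` — then
`g := (1/n) ∑_{j<n} Sⱼ` is continuous and `F + g ∘ Φ − g = Sₙ/n` pointwise (telescoping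
`Sⱼ(Φ x) − Sⱼ(x) = F(Φʲ x) − F x`) — or for every `n ≥ 1` there is `xₙ` with `Sₙ(xₙ)/n ≥ β`;
in the latter case the limit along a free ultrafilter of the empirical measures
`(1/n) ∑_{i<n} δ_{Φⁱ xₙ}` is a `Φ`-invariant Borel probability measure `m` with `∫ F dm ≥ β`,
contradicting the hypothesis. The empty space is vacuous (`g = 0`).
-/

open MeasureTheory Filter Topology

namespace Summit.NavierStokesRegularity.NavierStokesRegularity.Theorems

/-- Telescoping behind Jenkinson's device: summing `Sⱼ(Φ x) − Sⱼ(x) = F (Φʲ x) − F x` over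
`j < n` gives `∑_{j<n} Sⱼ(Φ x) − ∑_{j<n} Sⱼ(x) = Sₙ(x) − n • F x`
(`Sₙ = birkhoffSum Φ F n`). -/
theorem sum_birkhoffSum_apply_sub_sum_birkhoffSum {K : Type*} (Φ : K → K) (F : K → ℝ)
    (n : ℕ) (x : K) :
    (∑ j ∈ Finset.range n, birkhoffSum Φ F j (Φ x)) - (∑ j ∈ Finset.range n, birkhoffSum Φ F j x)
      = birkhoffSum Φ F n x - n * F x := by
  rw [← Finset.sum_sub_distrib]
  simp_rw [birkhoffSum_apply_sub_birkhoffSum]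
  rw [Finset.sum_sub_distrib, Finset.sum_const, Finset.card_range, nsmul_eq_mul]
  rfl

/-- Jenkinson's device: with `g := (1/n) ∑_{j<n} Sⱼ` (`n ≠ 0`) one has
`F x + g (Φ x) − g x = Sₙ(x) / n`. [cite: Jenkinson2018, proof of Prop. 2.2] -/
theorem add_cesaroBirkhoff_apply_sub_eq {K : Type*} (Φ : K → K) (F : K → ℝ) {n : ℕ}
    (hn : n ≠ 0) (x : K) :
    F x + (∑ j ∈ Finset.range n, birkhoffSum Φ F j (Φ x)) / (n : ℝ)
        - (∑ j ∈ Finset.range n, birkhoffSum Φ F j x) / (n : ℝ)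
      = birkhoffSum Φ F n x / (n : ℝ) := by
  have hn' : (n : ℝ) ≠ 0 := Nat.cast_ne_zero.2 hn
  rw [add_sub_assoc, ← sub_div, sum_birkhoffSum_apply_sub_sum_birkhoffSum]
  field_simp
  ring

/-- **Ergodic optimisation duality, non-trivial half** (item stmt-NavierStokesRegularity-2885,
route decl `Theses.TypeICertificateLadder.ErgodicOptimisationDuality`): for a continuous self-map
`Φ` of a compact metric space `K` and continuous `F : K → ℝ`, if every `Φ`-invariant Borel
probability measure `μ` has `∫ F dμ < β` then there is a continuous `g : K → ℝ` with
`F x + g (Φ x) - g x < β` for all `x`. Proof: if some `n ≥ 1` has `Sₙ(x)/n < β` everywhere, take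
`g := (1/n) ∑_{j<n} Sⱼ` (Jenkinson's device, `add_cesaroBirkhoff_apply_sub_eq`); otherwise pick
`xₙ` with `Sₙ(xₙ)/n ≥ β` and obtain, by Krylov–Bogolyubov along a free ultrafilter
(`Literature.Dynamics.Ergodic.exists_invariantMeasure_tendsto_timeAverage`), an invariant Borel
probability measure `m` with `∫ F dm ≥ β` — a contradiction. [cite: Jenkinson2018, Prop. 2.2] -/
theorem typeICertificateLadder_ergodicOptimisationDuality_proof :
    Summit.NavierStokesRegularity.NavierStokesRegularity.Theses.TypeICertificateLadder.ErgodicOptimisationDuality := by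
  unfold Summit.NavierStokesRegularity.NavierStokesRegularity.Theses.TypeICertificateLadder.ErgodicOptimisationDuality
  intro K _ _ _ _ Φ hΦ F hF β hμ
  rcases isEmpty_or_nonempty K with hK | hK
  · exact ⟨fun _ => 0, continuous_const, fun x => (IsEmpty.false x).elim⟩
  by_cases hex : ∃ n : ℕ, n ≠ 0 ∧ ∀ x : K, birkhoffSum Φ F n x / (n : ℝ) < β
  · -- Jenkinson's device
    obtain ⟨n, hn, hlt⟩ := hex
    refine ⟨fun x => (∑ j ∈ Finset.range n, birkhoffSum Φ F j x) / (n : ℝ), ?_, fun x => ?_⟩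
    · refine Continuous.div_const (continuous_finsetSum _ fun j _ => ?_) _
      change Continuous fun x => ∑ k ∈ Finset.range j, F (Φ^[k] x)
      exact continuous_finsetSum _ fun k _ => hF.comp (hΦ.iterate k)
    · change F x + (∑ j ∈ Finset.range n, birkhoffSum Φ F j (Φ x)) / (n : ℝ)
          - (∑ j ∈ Finset.range n, birkhoffSum Φ F j x) / (n : ℝ) < β
      rw [add_cesaroBirkhoff_apply_sub_eq Φ F hn x]
      exact hlt x
  · -- Krylov–Bogolyubov along a free ultrafilter: an invariant measure with `∫ F dm ≥ β`
    exfalso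
    push Not at hex
    have hch : ∀ n : ℕ, ∃ x : K, n ≠ 0 → β ≤ birkhoffSum Φ F n x / (n : ℝ) := by
      intro n
      rcases eq_or_ne n 0 with hn | hn
      · exact ⟨hK.some, fun h => (h hn).elim⟩
      · obtain ⟨x, hx⟩ := hex n hn
        exact ⟨x, fun _ => hx⟩
    choose xs hxs using hch
    have h𝒰 : ((hyperfilter ℕ : Ultrafilter ℕ) : Filter ℕ) ≤ atTop :=
      hyperfilter_le_cofinite.trans_eq Nat.cofinite_eq_atTop
    obtain ⟨m, hm, hinv, hlim⟩ :=
      Literature.Dynamics.Ergodic.exists_invariantMeasure_tendsto_timeAverage hΦ h𝒰 xs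
    have hβ : β ≤ ∫ y, F y ∂m :=
      ge_of_tendsto (hlim F hF)
        (((eventually_ne_atTop 0).filter_mono h𝒰).mono fun n hn => hxs n hn)
    exact (hμ m hm hinv).not_ge hβ

end Summit.NavierStokesRegularity.NavierStokesRegularity.Theorems
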